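import Summits.BirchSwinnertonDyer.BirchSwinnertonDyer.Theorems.ManinLocalTwoThreeTwoHauptmodul
import Summits.BirchSwinnertonDyer.BirchSwinnertonDyer.Theorems.ManinLocalTwoThreeAdditiveTwoJBound
import Summits.BirchSwinnertonDyer.BirchSwinnertonDyer.Theorems.ManinLocalTwoThreeAdditiveIsogenyInvariant
import Literature.NumberTheory.EllipticCurves.ModularParametrizationTrustBaseProofs
import Literature.NumberTheory.EllipticCurves.ModularParametrizationDegreeHoldsProofs
import Literature.NumberTheory.EllipticCurves.IsogenyConductorModularityProofs
import HarnessLib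

/-!
# THE NÉRON-SCALAR CLOCK LAW AT `2` (an's E-an-119 `TwoNeronScalarClockLaw`) — BY VALUE, granted conductor invariance along the isogeny

Summit `BirchSwinnertonDyer`, route `ManinLocalTwoThree` (cell bsd-f2-manin), cruxes C2 `ManinOddAtFour` (stmt-BirchSwinnertonDyer-22967) and
C3 `ManinPrimeToThreeAtNine` (stmt-…-22968).  an g25's charter answer at `2` (MEMO-an §67, Sketch-an-g25 :152 `TwoNeronScalarClockLaw`; census
573 266 directed rational `2`-isogenies with additive potentially good source, 0 violations): for `W/ℚ` globally minimal, additive and potentially good at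
`2` (`4 ∣ N`, `ord₂ j ≥ 0`), `q` a rational `2`-torsion abscissa, `K = K₂(W, T) = ord₂ Δ_min − 3·ord₂ g(x)` (`x = q − b₂/12`,
`g = 3x² + (b₂/2)x + b₄/2`), `m = m₂(W) = ord₂ Δ_min − ord₂ N + 1`:
**`K = 0 ⟹ u = 1`; `K = 12 ⟹ u = 2`; `1 ≤ K ≤ 11 ⟹ (u = 2 ⟺ m + K ≥ 13) ∧ (u = 1 ⟺ m + K ≤ 12)`**, where «`u = 1`» = some globally minimal curve
carries the `u = 1` Vélu `2`-pair `(A, B) = (720q² − 4c₄, 19008q³ − 144c₄q)` and «`u = 2`» = some globally minimal curve carries `(2⁻⁴A, 2⁻⁶B)`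
(an's `VeluTwoPairMinimal` / `VeluTwoPairTwiceMinimal`).

PROOF (all inputs are tree theorems except conductor invariance along the isogeny): p3-g7's ISOGENOUS carrier `(W′, k)`, `k ∣ 2`, with
`ord₂Δ_min(W′) = δ + K − 12·ord₂ k` (`exists_isIsogenous_dvd_two_velu_two`); additivity transfers (`sq_dvd_conductorNorm_of_isIsogenous`); the
`X₀(2)`-Hauptmodul classes (`…TwoHauptmodul`: `1 ≤ K ≤ 11 ⟹ W′` potentially supersingular; `K ∈ {0, 12} ⟹ ord₂ j(W′) = 0`); the WINDOWS
`1 ≤ m ≤ 12` (pss) / `≤ 13` (pot. good) of `…IstarTwoJValuation` (S-an-40′) and `12 ≤ ord₂Δ_min ≤ 20` for potentially ordinary additive fibres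
(`…AdditiveTwoJBound`); Ogg's `m = δ − f + 1` (`oggComponents_eq_numComponents_of_sq_dvd`); **`N(W′) = N(W)`** from modularity
(`conductorNorm_eq_of_isIsogenous_of_modularity_of_isGloballyMinimal`, schema `nonempty_modularParametrizationData` ⟸ `exists_isNewformOf` — the
crux's own fourth binder); and S-an-39's exclusivity `not_veluTwoPair_minimal_and_twiceMinimal` (§1) for the `⟺`.

* §1 `not_veluTwoPair_minimal_and_twiceMinimal`, `hauptK_eq_four_of_j_eq_zero`.
* §2 `twoNeronScalarClockLaw_of_modularity` (hypothesis `nonempty_modularParametrizationData`), `twoNeronScalarClockLaw_of_exists_isNewformOf`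
  (hypothesis `exists_isNewformOf`, the crux binder `hnf`) — E-an-119 VERBATIM BY VALUE (an's `hauptK₂`, `twoTorsionSlope`, `oggComponents`,
  `VeluTwoPairMinimal`, `VeluTwoPairTwiceMinimal`, `veluTwoC4/6` unfolded).

HONEST FRAMING: E-an-119 becomes a theorem MODULO conductor invariance along the `2`-isogeny (here: modularity; the tree's unconditional
alternative is the Ogg–Saito schema of `…IsogenyConductorProofs`).  C2, C3, Manin's conjecture and BSD are not proved.  No definitions, no named facts,
no sorry.  References: [DokchitserDokchitser2015LocalInvariants] Table 1, §4; [SilvermanATAEC1994] IV.9.4, IV.11.1; [AtkinLehner1970] Thm. 4.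
-/

set_option linter.dupNamespace false
set_option autoImplicit false

noncomputable section

open scoped Classical

open WeierstrassCurve IsDedekindDomain IsLocalRing
  Literature.NumberTheory.DiophantineGeometry Literature.NumberTheory.DiophantineGeometry.TateAlgorithm
  Literature.NumberTheory.EllipticCurves Literature.NumberTheory.EllipticCurves.ModularForms

namespace Summit.BirchSwinnertonDyer.BirchSwinnertonDyer.Theorems.ManinLocalTwoThree

open NumberField Rat.HeightOneSpectrum Summit.BirchSwinnertonDyer.Rank1Residual.Additive

/-! ### §1 Exclusivity of the two Néron scalars; `j = 0 ⟹ K = 4` -/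

/-- **S-an-39, exclusivity:** no pair `(A, B)` is carried by a globally minimal elliptic curve and, divided by `(2⁴, 2⁶)`, by another — the two
would be `ℚ`-isomorphic (`exists_variableChange_of_c₄_eq_of_c₆_eq'`) globally minimal models, which differ by `u = ±1`
(`isGloballyMinimal_unique_holds`), forcing `A = B = 0`, `Δ = 0`. [cite: SilvermanAEC2009, VII.1.3(b) and VIII.8.3] -/
theorem not_veluTwoPair_minimal_and_twiceMinimal (A B : ℚ) :
    ¬ ((∃ W₁ : WeierstrassCurve ℚ, W₁.IsElliptic ∧ W₁.IsGloballyMinimal ∧ W₁.c₄ = A ∧ W₁.c₆ = B) ∧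
       (∃ W₂ : WeierstrassCurve ℚ, W₂.IsElliptic ∧ W₂.IsGloballyMinimal ∧ (2 : ℚ) ^ 4 * W₂.c₄ = A ∧ (2 : ℚ) ^ 6 * W₂.c₆ = B)) := by
  rintro ⟨⟨W₁, hE₁, hM₁, h4₁, h6₁⟩, ⟨W₂, hE₂, hM₂, h4₂, h6₂⟩⟩
  haveI := hE₁; haveI := hM₁; haveI := hE₂; haveI := hM₂
  have h₄ : W₂.c₄ = ((2 : ℚ) ^ 4)⁻¹ * W₁.c₄ := by rw [h4₁, ← h4₂]; field_simp
  have h₆ : W₂.c₆ = ((2 : ℚ) ^ 6)⁻¹ * W₁.c₆ := by rw [h6₁, ← h6₂]; field_simp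
  obtain ⟨C, hC⟩ := exists_variableChange_of_c₄_eq_of_c₆_eq' (W₁ := W₁) (W₂ := W₂) (w := (2 : ℚ)) two_ne_zero h₄ h₆
  haveI : (C • W₁).IsGloballyMinimal := hC ▸ hM₂
  obtain ⟨hu, -⟩ := isGloballyMinimal_unique_holds W₁ C
  have hu4 : ((C.u : ℚ))⁻¹ ^ 4 = 1 := by rcases hu with h | h <;> norm_num [h]
  have hc₄ : W₂.c₄ = W₁.c₄ := by rw [← hC, variableChange_c₄, Units.val_inv_eq_inv_val, hu4, one_mul]
  have hA : A = 0 := by have := h4₂; rw [hc₄, h4₁] at this; linarith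
  have hu6 : ((C.u : ℚ))⁻¹ ^ 6 = 1 := by rcases hu with h | h <;> norm_num [h]
  have hc₆ : W₂.c₆ = W₁.c₆ := by rw [← hC, variableChange_c₆, Units.val_inv_eq_inv_val, hu6, one_mul]
  have hB : B = 0 := by have := h6₂; rw [hc₆, h6₁] at this; linarith
  have hc4 : W₁.c₄ = 0 := h4₁.trans hA
  have hc6 : W₁.c₆ = 0 := h6₁.trans hB
  have hrel := W₁.c_relation
  rw [hc4, hc6] at hrel
  have hΔ : W₁.Δ = 0 := by linear_combination hrel / 1728
  exact W₁.Δ'.ne_zero (by rw [WeierstrassCurve.coe_Δ']; exact hΔ)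

/-- `j = 0 ⟹ K = 4` (`c₄ = 0`, so `16 g³ = −Δ`). [cite: DokchitserDokchitser2015LocalInvariants, Table 1] -/
theorem hauptK_eq_four_of_j_eq_zero (W : WeierstrassCurve ℚ) [W.IsElliptic] [W.IsGloballyMinimal] (q : ℚ)
    (hq : W.Ψ₂Sq.eval (q - W.b₂ / 12) = 0) (hj : W.j = 0) :
    (padicValInt 2 W.minimalDiscriminantInt : ℤ) - 3 * padicValRat 2 (3 * q ^ 2 - W.c₄ / 48) = 4 := by
  haveI : Fact (Nat.Prime 2) := ⟨Nat.prime_two⟩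
  have hB0 : 3 * q ^ 2 - W.c₄ / 48 ≠ 0 := velu_two_B_ne_zero W q hq
  have hc₄ : W.c₄ = 0 := (j_eq_zero_iff_c₄_eq_zero W).mp hj
  have hid := c₄_mul_veluB_sq W q hq
  rw [hc₄] at hid
  have hsum : 16 * (3 * q ^ 2 - 0 / 48) ^ 3 = -W.Δ := by linear_combination -hid
  have hB0' : 3 * q ^ 2 - 0 / 48 ≠ 0 := by rw [hc₄] at hB0; exact hB0
  have hv16 : padicValRat 2 (16 * (3 * q ^ 2 - 0 / 48) ^ 3) = 4 + 3 * padicValRat 2 (3 * q ^ 2 - 0 / 48) := by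
    rw [show (16 : ℚ) = (2 : ℚ) ^ 4 by norm_num, padicValRat_two_pow_mul_cube 4 hB0']; push_cast; ring
  have hδ : padicValRat 2 W.Δ = padicValInt 2 W.minimalDiscriminantInt := by
    rw [← cast_minimalDiscriminantInt W, padicValRat.of_int]
  rw [hsum, padicValRat.neg, hδ] at hv16
  rw [hc₄]; linarith

/-! ### §2 The clock law -/

/-- **E-an-119 `TwoNeronScalarClockLaw`, BY VALUE, granted `nonempty_modularParametrizationData`** (conductor invariance along the `2`-isogeny).
[cite: DokchitserDokchitser2015LocalInvariants, Table 1 and §4 Lemma 10] [cite: SilvermanATAEC1994, IV.9.4 Table 4.1 and IV.11.1] [cite: AtkinLehner1970, Thm. 4] -/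
theorem twoNeronScalarClockLaw_of_modularity (hmod : nonempty_modularParametrizationData)
    (W : WeierstrassCurve ℚ) [W.IsElliptic] [W.IsGloballyMinimal] (h4 : 2 ^ 2 ∣ W.conductorNorm ℤ) (hj : 0 ≤ padicValRat 2 W.j)
    (q : ℚ) (hq : W.Ψ₂Sq.eval (q - W.b₂ / 12) = 0) :
    ((padicValInt 2 W.minimalDiscriminantInt : ℤ) - 3 * padicValRat 2 (3 * (q - W.b₂ / 12) ^ 2 + W.b₂ / 2 * (q - W.b₂ / 12) + W.b₄ / 2) = 0 →
      ∃ W' : WeierstrassCurve ℚ, W'.IsElliptic ∧ W'.IsGloballyMinimal ∧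
        W'.c₄ = 720 * q ^ 2 - 4 * W.c₄ ∧ W'.c₆ = 19008 * q ^ 3 - 144 * W.c₄ * q) ∧
    ((padicValInt 2 W.minimalDiscriminantInt : ℤ) - 3 * padicValRat 2 (3 * (q - W.b₂ / 12) ^ 2 + W.b₂ / 2 * (q - W.b₂ / 12) + W.b₄ / 2) = 12 →
      ∃ W' : WeierstrassCurve ℚ, W'.IsElliptic ∧ W'.IsGloballyMinimal ∧
        (2 : ℚ) ^ 4 * W'.c₄ = 720 * q ^ 2 - 4 * W.c₄ ∧ (2 : ℚ) ^ 6 * W'.c₆ = 19008 * q ^ 3 - 144 * W.c₄ * q) ∧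
    (1 ≤ (padicValInt 2 W.minimalDiscriminantInt : ℤ) - 3 * padicValRat 2 (3 * (q - W.b₂ / 12) ^ 2 + W.b₂ / 2 * (q - W.b₂ / 12) + W.b₄ / 2) →
      (padicValInt 2 W.minimalDiscriminantInt : ℤ) - 3 * padicValRat 2 (3 * (q - W.b₂ / 12) ^ 2 + W.b₂ / 2 * (q - W.b₂ / 12) + W.b₄ / 2) ≤ 11 →
      ((∃ W' : WeierstrassCurve ℚ, W'.IsElliptic ∧ W'.IsGloballyMinimal ∧
          (2 : ℚ) ^ 4 * W'.c₄ = 720 * q ^ 2 - 4 * W.c₄ ∧ (2 : ℚ) ^ 6 * W'.c₆ = 19008 * q ^ 3 - 144 * W.c₄ * q) ↔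
        13 ≤ (padicValInt 2 W.minimalDiscriminantInt : ℤ) - (padicValNat 2 (W.conductorNorm ℤ) : ℤ) + 1 +
          ((padicValInt 2 W.minimalDiscriminantInt : ℤ) -
            3 * padicValRat 2 (3 * (q - W.b₂ / 12) ^ 2 + W.b₂ / 2 * (q - W.b₂ / 12) + W.b₄ / 2))) ∧
      ((∃ W' : WeierstrassCurve ℚ, W'.IsElliptic ∧ W'.IsGloballyMinimal ∧
          W'.c₄ = 720 * q ^ 2 - 4 * W.c₄ ∧ W'.c₆ = 19008 * q ^ 3 - 144 * W.c₄ * q) ↔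
        (padicValInt 2 W.minimalDiscriminantInt : ℤ) - (padicValNat 2 (W.conductorNorm ℤ) : ℤ) + 1 +
          ((padicValInt 2 W.minimalDiscriminantInt : ℤ) -
            3 * padicValRat 2 (3 * (q - W.b₂ / 12) ^ 2 + W.b₂ / 2 * (q - W.b₂ / 12) + W.b₄ / 2)) ≤ 12)) := by
  haveI : Fact (Nat.Prime 2) := ⟨Nat.prime_two⟩
  haveI : PerfectField (IsLocalRing.ResidueField ((placeOf 2).adicCompletionIntegers ℚ)) := PerfectField.ofFinite
  rw [twoTorsionSlope_eq_veluB W q]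
  set K : ℤ := (padicValInt 2 W.minimalDiscriminantInt : ℤ) - 3 * padicValRat 2 (3 * q ^ 2 - W.c₄ / 48) with hKdef
  -- Ogg's `m` for `W`, additivity, `δ ≤ 20`
  obtain ⟨hm, hadd⟩ := oggComponents_eq_numComponents_of_sq_dvd W 2 h4
  have haddW : W.HasAdditiveReductionAt (placeOf 2) := (isAdditive_kodairaSymbolAt_iff_holds (placeOf 2) W).mp hadd
  have hδ : W.ordMinimalDiscriminant (placeOf 2) = padicValInt 2 W.minimalDiscriminantInt := ordMinimalDiscriminant_placeOf_eq W 2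
  have h20 := ordMinimalDiscriminant_le_twenty_of_potGood_additive_two W haddW hj
  -- the isogenous carrier
  obtain ⟨W', k, hE', hM', hiso, hk2, hk0, h4', h6', hbook⟩ := exists_isIsogenous_dvd_two_velu_two W q hq
  have hb := hbook 2
  have hkQ : (k : ℚ) ≠ 0 := by exact_mod_cast hk0
  have h4N' : 2 ^ 2 ∣ W'.conductorNorm ℤ := sq_dvd_conductorNorm_of_isIsogenous 2 h4 hiso
  obtain ⟨hm', hadd'⟩ := oggComponents_eq_numComponents_of_sq_dvd W' 2 h4N'
  have haddW' : W'.HasAdditiveReductionAt (placeOf 2) := (isAdditive_kodairaSymbolAt_iff_holds (placeOf 2) W').mp hadd'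
  have hδ' : W'.ordMinimalDiscriminant (placeOf 2) = padicValInt 2 W'.minimalDiscriminantInt := ordMinimalDiscriminant_placeOf_eq W' 2
  have hN : W.conductorNorm ℤ = W'.conductorNorm ℤ := conductorNorm_eq_of_isIsogenous_of_modularity_of_isGloballyMinimal hmod hiso
  rw [← hN] at hm'
  have hm1' := (W'.kodairaSymbolAt (placeOf 2)).numComponents_pos
  -- `k ∈ {±1, ±2}`
  have hkcases : (padicValInt 2 k = 0 ∧ (k : ℚ) ^ 4 = 1 ∧ (k : ℚ) ^ 6 = 1) ∨
      (padicValInt 2 k = 1 ∧ (k : ℚ) ^ 4 = 2 ^ 4 ∧ (k : ℚ) ^ 6 = 2 ^ 6) := by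
    have hk2' : k.natAbs ≤ 2 := by simpa using Nat.le_of_dvd two_pos (Int.natAbs_dvd_natAbs.mpr hk2)
    have hlo : -2 ≤ k := by omega
    have hhi : k ≤ 2 := by omega
    have hv2 : padicValInt 2 2 = 1 := padicValInt_self
    have hv2' : padicValInt 2 (-2) = 1 := by
      rw [show padicValInt 2 (-2) = padicValInt 2 2 from by simp [padicValInt]]; exact padicValInt_self
    interval_cases k
    · right; exact ⟨hv2', by norm_num, by norm_num⟩
    · left; exact ⟨by simp [padicValInt], by norm_num, by norm_num⟩
    · exact absurd rfl hk0
    · left; exact ⟨by simp [padicValInt], by norm_num, by norm_num⟩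
    · right; exact ⟨hv2, by norm_num, by norm_num⟩
  -- the two scenarios
  have hmin_of : padicValInt 2 k = 0 → (k : ℚ) ^ 4 = 1 → (k : ℚ) ^ 6 = 1 →
      (∃ W' : WeierstrassCurve ℚ, W'.IsElliptic ∧ W'.IsGloballyMinimal ∧
        W'.c₄ = 720 * q ^ 2 - 4 * W.c₄ ∧ W'.c₆ = 19008 * q ^ 3 - 144 * W.c₄ * q) := fun _ hk4 hk6 ↦
    ⟨W', hE', hM', by rw [← h4', hk4, one_mul], by rw [← h6', hk6, one_mul]⟩
  have htwice_of : (k : ℚ) ^ 4 = 2 ^ 4 → (k : ℚ) ^ 6 = 2 ^ 6 →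
      (∃ W' : WeierstrassCurve ℚ, W'.IsElliptic ∧ W'.IsGloballyMinimal ∧
        (2 : ℚ) ^ 4 * W'.c₄ = 720 * q ^ 2 - 4 * W.c₄ ∧ (2 : ℚ) ^ 6 * W'.c₆ = 19008 * q ^ 3 - 144 * W.c₄ * q) := fun hk4 hk6 ↦
    ⟨W', hE', hM', by rw [← h4', hk4], by rw [← h6', hk6]⟩
  have hexcl := not_veluTwoPair_minimal_and_twiceMinimal (720 * q ^ 2 - 4 * W.c₄) (19008 * q ^ 3 - 144 * W.c₄ * q)
  refine ⟨fun hK0 ↦ ?_, fun hK12 ↦ ?_, fun hK1 hK11 ↦ ?_⟩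
  · -- `K = 0`: the carrier has `ord₂ j = 0`; if `k = ±2` then `δ' = δ − 12 ≥ 12`, so `δ ≥ 24 > 20`
    rcases hkcases with ⟨he, hk4, hk6⟩ | ⟨he, hk4, hk6⟩
    · exact hmin_of he hk4 hk6
    · exfalso
      obtain ⟨hj'0, hj'ne⟩ := padicValRat_two_j_velu_carrier_eq_zero W q hq W' hkQ h4' h6' (Or.inl hK0)
      have h12 := twelve_le_ordMinimalDiscriminant_of_potOrdinary_additive_two W' haddW' hj'ne hj'0
      rw [hδ'] at h12; rw [hδ] at h20
      rw [he] at hb; push_cast at hb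
      have : (12 : ℤ) ≤ padicValInt 2 W'.minimalDiscriminantInt := by exact_mod_cast h12
      have : (padicValInt 2 W.minimalDiscriminantInt : ℤ) ≤ 20 := by exact_mod_cast h20
      linarith
  · -- `K = 12`: `W` has `ord₂ j = 0`, so `δ ≥ 12`; if `k = ±1` then `δ' = δ + 12 ≥ 24 > 20`
    rcases hkcases with ⟨he, hk4, hk6⟩ | ⟨he, hk4, hk6⟩
    · exfalso
      have hjW : W.j ≠ 0 := fun h0 ↦ by have := hauptK_eq_four_of_j_eq_zero W q hq h0; linarith
      obtain ⟨-, hgt, -⟩ := padicValRat_two_j_of_hauptK W q hq K rfl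
      have hjv : padicValRat 2 W.j = 0 := by rw [hgt (by linarith)]; linarith
      have h12 := twelve_le_ordMinimalDiscriminant_of_potOrdinary_additive_two W haddW hjW hjv
      obtain ⟨hj'0, -⟩ := padicValRat_two_j_velu_carrier_eq_zero W q hq W' hkQ h4' h6' (Or.inr hK12)
      have h20' := ordMinimalDiscriminant_le_twenty_of_potGood_additive_two W' haddW' (le_of_eq hj'0.symm)
      rw [hδ] at h12; rw [hδ'] at h20'
      rw [he] at hb; push_cast at hb
      have : (12 : ℤ) ≤ padicValInt 2 W.minimalDiscriminantInt := by exact_mod_cast h12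
      have : (padicValInt 2 W'.minimalDiscriminantInt : ℤ) ≤ 20 := by exact_mod_cast h20'
      linarith
    · exact htwice_of hk4 hk6
  · -- `1 ≤ K ≤ 11`: the carrier is potentially supersingular, so `1 ≤ m' ≤ 12` with `m' = m + K − 12·ord₂ k`
    have hss' := potSupersingular_two_velu_carrier W q hq W' hkQ h4' h6' hK1 hK11
    have h12' := numComponents_le_twelve_of_potSupersingular_two W' hadd' hss'
    have hm12' : ((W'.kodairaSymbolAt (placeOf 2)).numComponents : ℤ) ≤ 12 := by exact_mod_cast h12'
    have hm1 : (1 : ℤ) ≤ (W'.kodairaSymbolAt (placeOf 2)).numComponents := by exact_mod_cast hm1'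
    rcases hkcases with ⟨he, hk4, hk6⟩ | ⟨he, hk4, hk6⟩
    · -- `k = ±1`: `m' = m + K`, so `m + K ≤ 12`; `u = 1` holds, `u = 2` fails by exclusivity
      rw [he] at hb; push_cast at hb
      have hmin := hmin_of he hk4 hk6
      have hle : (padicValInt 2 W.minimalDiscriminantInt : ℤ) - (padicValNat 2 (W.conductorNorm ℤ) : ℤ) + 1 + K ≤ 12 := by linarith
      refine ⟨⟨fun htw ↦ absurd ⟨hmin, htw⟩ hexcl, fun h ↦ by linarith⟩, ⟨fun _ ↦ hle, fun _ ↦ hmin⟩⟩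
    · -- `k = ±2`: `m' = m + K − 12`, so `m + K ≥ 13`; `u = 2` holds, `u = 1` fails by exclusivity
      rw [he] at hb; push_cast at hb
      have htw := htwice_of hk4 hk6
      have hge : 13 ≤ (padicValInt 2 W.minimalDiscriminantInt : ℤ) - (padicValNat 2 (W.conductorNorm ℤ) : ℤ) + 1 + K := by linarith
      refine ⟨⟨fun _ ↦ hge, fun _ ↦ htw⟩, ⟨fun hmn ↦ absurd ⟨hmn, htw⟩ hexcl, fun h ↦ by linarith⟩⟩

/-- **E-an-119 `TwoNeronScalarClockLaw`, BY VALUE, granted the Modularity Theorem `exists_isNewformOf`** (the crux's fourth binder `hnf`).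
[cite: DokchitserDokchitser2015LocalInvariants, Table 1] [cite: DiamondShurman2005, Thm. 8.8.3] -/
theorem twoNeronScalarClockLaw_of_exists_isNewformOf (hnf : exists_isNewformOf)
    (W : WeierstrassCurve ℚ) [W.IsElliptic] [W.IsGloballyMinimal] (h4 : 2 ^ 2 ∣ W.conductorNorm ℤ) (hj : 0 ≤ padicValRat 2 W.j)
    (q : ℚ) (hq : W.Ψ₂Sq.eval (q - W.b₂ / 12) = 0) :
    ((padicValInt 2 W.minimalDiscriminantInt : ℤ) - 3 * padicValRat 2 (3 * (q - W.b₂ / 12) ^ 2 + W.b₂ / 2 * (q - W.b₂ / 12) + W.b₄ / 2) = 0 →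
      ∃ W' : WeierstrassCurve ℚ, W'.IsElliptic ∧ W'.IsGloballyMinimal ∧
        W'.c₄ = 720 * q ^ 2 - 4 * W.c₄ ∧ W'.c₆ = 19008 * q ^ 3 - 144 * W.c₄ * q) ∧
    ((padicValInt 2 W.minimalDiscriminantInt : ℤ) - 3 * padicValRat 2 (3 * (q - W.b₂ / 12) ^ 2 + W.b₂ / 2 * (q - W.b₂ / 12) + W.b₄ / 2) = 12 →
      ∃ W' : WeierstrassCurve ℚ, W'.IsElliptic ∧ W'.IsGloballyMinimal ∧
        (2 : ℚ) ^ 4 * W'.c₄ = 720 * q ^ 2 - 4 * W.c₄ ∧ (2 : ℚ) ^ 6 * W'.c₆ = 19008 * q ^ 3 - 144 * W.c₄ * q) ∧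
    (1 ≤ (padicValInt 2 W.minimalDiscriminantInt : ℤ) - 3 * padicValRat 2 (3 * (q - W.b₂ / 12) ^ 2 + W.b₂ / 2 * (q - W.b₂ / 12) + W.b₄ / 2) →
      (padicValInt 2 W.minimalDiscriminantInt : ℤ) - 3 * padicValRat 2 (3 * (q - W.b₂ / 12) ^ 2 + W.b₂ / 2 * (q - W.b₂ / 12) + W.b₄ / 2) ≤ 11 →
      ((∃ W' : WeierstrassCurve ℚ, W'.IsElliptic ∧ W'.IsGloballyMinimal ∧
          (2 : ℚ) ^ 4 * W'.c₄ = 720 * q ^ 2 - 4 * W.c₄ ∧ (2 : ℚ) ^ 6 * W'.c₆ = 19008 * q ^ 3 - 144 * W.c₄ * q) ↔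
        13 ≤ (padicValInt 2 W.minimalDiscriminantInt : ℤ) - (padicValNat 2 (W.conductorNorm ℤ) : ℤ) + 1 +
          ((padicValInt 2 W.minimalDiscriminantInt : ℤ) -
            3 * padicValRat 2 (3 * (q - W.b₂ / 12) ^ 2 + W.b₂ / 2 * (q - W.b₂ / 12) + W.b₄ / 2))) ∧
      ((∃ W' : WeierstrassCurve ℚ, W'.IsElliptic ∧ W'.IsGloballyMinimal ∧
          W'.c₄ = 720 * q ^ 2 - 4 * W.c₄ ∧ W'.c₆ = 19008 * q ^ 3 - 144 * W.c₄ * q) ↔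
        (padicValInt 2 W.minimalDiscriminantInt : ℤ) - (padicValNat 2 (W.conductorNorm ℤ) : ℤ) + 1 +
          ((padicValInt 2 W.minimalDiscriminantInt : ℤ) -
            3 * padicValRat 2 (3 * (q - W.b₂ / 12) ^ 2 + W.b₂ / 2 * (q - W.b₂ / 12) + W.b₄ / 2)) ≤ 12)) :=
  twoNeronScalarClockLaw_of_modularity
    (nonempty_modularParametrizationData_of_exists_isNewformOf hnf IsNewformOf.exists_maninConstant_ne_zero_holds) W h4 hj q hq

end Summit.BirchSwinnertonDyer.BirchSwinnertonDyer.Theorems.ManinLocalTwoThree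

end
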